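import Summits.NavierStokesRegularity.FunctionalMining.StretchingLaminateCalculus
import Mathlib.Tactic.Linarith
import HarnessLib

/-!
# FunctionalMining — K1-Q1 laminates: the power-of-the-point cap on created enstrophy (dict seat)

search for candidate a priori estimates; no regularity claim.  Elementary identities of the finite div-free
lamination-tree calculus (`StretchingLaminates`, `StretchingLaminateCalculus`); nothing about Navier–Stokes
solutions.

Bank g6's exact fact (E1) of `K1Q1-LAMINATE-BURKHOLDER.md` §9.3, typed.  At a split of a node in state `G` with
weight fraction `λ` and layer `B = c ⊗ n` (vorticity jump `w = n × c`), the children are `G₊ = G + (1−λ)B` and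
`G₋ = G − λB`, and the enstrophy CREATED at the split (per unit weight, in vorticity units) is `λ(1−λ)|w|²`
(`Grad.vortSq_split`).  **Power of the point**: if both children have `|ω|² ≤ M` then
`|ω(G)|² + λ(1−λ)|w|² ≤ M` — the created enstrophy is at most the ROOM `M − |ω(G)|²` left at the node
(`Grad.vortSq_add_created_le_of_split`; geometrically `d₊d₋ ≤ 1 − |ω|²` for a chord of the unit ball through `ω`).
This sharpens the barycentre bound `Grad.vortSq_le_of_split` (`|ω(G)|² ≤ M`) and is the exact local row behind the
production-aware envelope LP of the bank (§9.2): with a Rayleigh bound `wᵀ S_G w ≤ κ|w|²` (`κ ≥ 0`) the production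
created at the split, `λ(1−λ)·wᵀ S_G w` (`Grad.stretch_split`, independent of the layer's own strain), is at most
`κ·(M − |ω(G)|²)` (`Grad.created_stretch_le_room`).  No claim about `C_lam` or `C⋆` is made here.
search for candidate a priori estimates; no regularity claim.
-/


namespace Summit.NavierStokesRegularity.FunctionalMining

namespace Laminate

namespace Grad

/-- **Power of the point** (bank (E1)): if both children of a split with `λ ∈ [0,1]` have `|ω|² ≤ M`, then
`|ω(G)|² + λ(1−λ)|w|² ≤ M` — created enstrophy ≤ room. [ours; elementary] -/
theorem vortSq_add_created_le_of_split (G : Grad) (s : Split) (h0 : 0 ≤ s.lam) (h1 : s.lam ≤ 1) {M : ℚ}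
    (hp : (G.layer (1 - s.lam) s).vortSq ≤ M) (hm : (G.layer (-s.lam) s).vortSq ≤ M) :
    G.vortSq + s.lam * (1 - s.lam) * s.wSq ≤ M := by
  have hid := vortSq_split G s
  have h2 : s.lam * (G.layer (1 - s.lam) s).vortSq ≤ s.lam * M := mul_le_mul_of_nonneg_left hp h0
  have h3 : (1 - s.lam) * (G.layer (-s.lam) s).vortSq ≤ (1 - s.lam) * M :=
    mul_le_mul_of_nonneg_left hm (by linarith)
  nlinarith

/-- The same, as a bound on the created enstrophy alone: `λ(1−λ)|w|² ≤ M − |ω(G)|²`. [ours; elementary] -/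
theorem created_vortSq_le_room (G : Grad) (s : Split) (h0 : 0 ≤ s.lam) (h1 : s.lam ≤ 1) {M : ℚ}
    (hp : (G.layer (1 - s.lam) s).vortSq ≤ M) (hm : (G.layer (-s.lam) s).vortSq ≤ M) :
    s.lam * (1 - s.lam) * s.wSq ≤ M - G.vortSq := by
  have h := vortSq_add_created_le_of_split G s h0 h1 hp hm
  linarith

/-- **Created production ≤ κ · room**: with a Rayleigh bound `wᵀ S_G w ≤ κ|w|²`, `κ ≥ 0`, the production created at
the split (`Grad.stretch_split`) obeys `λ(1−λ)·wᵀ S_G w ≤ κ·(M − |ω(G)|²)`. [ours; elementary] -/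
theorem created_stretch_le_room (G : Grad) (s : Split) (h0 : 0 ≤ s.lam) (h1 : s.lam ≤ 1) {M κ : ℚ}
    (hκ : 0 ≤ κ) (hR : G.quadS s.w0 s.w1 s.w2 ≤ κ * s.wSq)
    (hp : (G.layer (1 - s.lam) s).vortSq ≤ M) (hm : (G.layer (-s.lam) s).vortSq ≤ M) :
    s.lam * (1 - s.lam) * G.quadS s.w0 s.w1 s.w2 ≤ κ * (M - G.vortSq) := by
  have hroom := created_vortSq_le_room G s h0 h1 hp hm
  have hl : 0 ≤ s.lam * (1 - s.lam) := mul_nonneg h0 (by linarith)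
  have h2 : s.lam * (1 - s.lam) * G.quadS s.w0 s.w1 s.w2 ≤ s.lam * (1 - s.lam) * (κ * s.wSq) :=
    mul_le_mul_of_nonneg_left hR hl
  have h3 : κ * (s.lam * (1 - s.lam) * s.wSq) ≤ κ * (M - G.vortSq) := mul_le_mul_of_nonneg_left hroom hκ
  nlinarith

end Grad

end Laminate

end Summit.NavierStokesRegularity.FunctionalMining
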